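import Summits.ResolutionOfSingularities.ResolutionOfSingularities.Theorems.HigherRankTermination.Negative.ConclusionFalseWithoutFG
import Summits.ResolutionOfSingularities.ResolutionOfSingularities.Theorems.SyzygyFlatteningDefs

/-!
# `A.FG` is load-bearing for RESIDUAL STEERING (`stub_residualSteering`, line `birth`)

Disprover (cdisprove, gen 2) negative lemma for the crux `SyzygyFlattening.HigherRankTermination`,
supporting `stmt-ResolutionOfSingularities-17045`.

The lead's line `birth` reduces the crux (kernel-checked, `…CruxIsResidualSteering`) to ONE stub,
residual steering: for `O` dimension-zero of rank `≥ 2`, a proper coarsening `O < O₁ < K` at whose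
centre the `O`-tower is eventually regular forces `TowerTerminates O A`. Gen 1 showed that the bare
conclusion `TowerTerminates` is false once the binder `A.FG` is deleted (`dimZeroTermination_false_without_FG`).
Here we show that the extra steering hypotheses of the stub — `O < O₁`, `O₁ ≠ ⊤`,
`EventuallyRegularAlong O A O₁` — do NOT rescue it without `A.FG`:

* witness: `k = 𝔽_p`, `K = 𝔽_p((t^{ℤ ×ₗ ℤ}))` (Hahn series), `O` = the rank-two Hahn valuation ring,
  `A = O`, and `O₁` = the valuation ring of the FIRST-COORDINATE valuation `x ↦ exp (-(order x).1)`
  (the rank-one coarsening of `O`);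
* `O₁` is a discrete valuation ring (value group `ℤ`), hence a regular local ring, and
  `locAt O₁ (tower O A m) = locAt O₁ O = O₁` for every `m` (the tower is constantly `O`,
  `tower_valuationSubring`), so `EventuallyRegularAlong O A O₁` holds from stage `0`;
* `O < O₁` (`t^{(0,-1)} ∈ O₁ ∖ O`), `O₁ ≠ ⊤` (`t^{(-1,0)} ∉ O₁`), `DimZero` (residue field `𝔽_p`);
* yet no stage `tower O A m = O` is regular (`O` is not Noetherian).

So any proof of `stub_residualSteering` must use finite generation of `A` BEYOND the regularity of
the coarsening: the steering data alone carry no Noetherianity down to the centre of `O`.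
This is a negative lemma (hypothesis analysis), not a refutation: the crux's models have `A.FG`.
-/

set_option linter.dupNamespace false

namespace Summit.ResolutionOfSingularities.ResolutionOfSingularities.Theorems.HigherRankTermination.Negative

open Summit.ResolutionOfSingularities.ResolutionOfSingularities.Theorems.SyzygyFlattening
  (locAt DimZero RegularAlong EventuallyRegularAlong TowerTerminates)

/-! ## Generalities: the route's named tower is the verbatim tower; `locAt` of a valuation ring -/

section General

variable {k K : Type} [Field k] [Field K] [Algebra k K]

/-- The named tower of `Theorems/SyzygyFlatteningDefs` is, on the nose, the verbatim `let`-tower of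
`Negative/ValuationRingFixedPoint` (δ/ζ-reduction only). -/
theorem sfTower_eq_tower (O : ValuationSubring K) (A : Subalgebra k K) (m : ℕ) :
    SyzygyFlattening.tower O A m = tower k K O A m := rfl

/-- For valuation subrings `O ≤ O₁` of `K` (containing `k`), the route's localisation of `O` at the
centre of `O₁` is `O₁` itself: `x ∈ O₁ ∖ O` is `1 * (x⁻¹)⁻¹` with `x⁻¹ ∈ O`. -/
theorem locAt_valuationSubalgebra_of_le (O O₁ : ValuationSubring K)
    (hk : ∀ c : k, algebraMap k K c ∈ O) (h : O ≤ O₁) :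
    locAt O₁ (valuationSubalgebra O hk) = valuationSubalgebra O₁ (fun c => h (hk c)) := by
  refine le_antisymm (Algebra.adjoin_le ?_) ?_
  · rintro y ⟨a, ha, s, -, hsO, rfl⟩
    exact O₁.mul_mem _ _ (h ha) hsO
  · intro x hx
    by_cases hxO : x ∈ O
    · refine Algebra.subset_adjoin ⟨x, hxO, 1, O.one_mem, ?_, by simp⟩
      rw [inv_one]
      exact O₁.one_mem
    · have hinv : x⁻¹ ∈ O := (O.mem_or_inv_mem x).resolve_left hxO
      refine Algebra.subset_adjoin ⟨1, O.one_mem, x⁻¹, hinv, ?_, ?_⟩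
      · rw [inv_inv]
        exact hx
      · rw [inv_inv, one_mul]

/-- Regularity of `O` transports to its underlying `k`-subalgebra (same ring). -/
theorem isRegularLocalRing_valuationSubalgebra (O : ValuationSubring K)
    (hk : ∀ c : k, algebraMap k K c ∈ O) [IsRegularLocalRing ↥O] :
    IsRegularLocalRing ↥(valuationSubalgebra O hk) :=
  IsRegularLocalRing.of_ringEquiv (R := ↥O)
    { toFun := fun x => ⟨x.1, x.2⟩
      invFun := fun x => ⟨x.1, x.2⟩
      left_inv := fun _ => rfl
      right_inv := fun _ => rfl
      map_mul' := fun _ _ => rfl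
      map_add' := fun _ _ => rfl }

end General

/-! ## The rank-one coarsening `O₁` of the rank-two Hahn witness -/

section Witness

variable (p : ℕ) [hp : Fact p.Prime]

/-- **The first-coordinate valuation** of `K = 𝔽_p((t^{ℤ ×ₗ ℤ}))` exists: a valuation `v` with values
in `ℤₘ₀` and `v x = exp (-(order x).1)` for `x ≠ 0` — the rank-one coarsening of the Hahn valuation
(multiplicativity: `order (x*y) = order x + order y`; ultrametricity: `min (order x) (order y) ≤
order (x+y)` and the first projection `ℤ ×ₗ ℤ → ℤ` is monotone). Stated existentially so that this
file declares no data. -/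
theorem exists_fstVal : ∃ v : Valuation (HK p) (WithZero (Multiplicative ℤ)),
    ∀ x : HK p, x ≠ 0 → v x = WithZero.exp (-(ofLex x.order).1) := by
  classical
  refine ⟨{ toFun := fun x => if x = 0 then 0 else WithZero.exp (-(ofLex x.order).1)
            map_zero' := if_pos rfl
            map_one' := ?_
            map_mul' := ?_
            map_add_le_max' := ?_ }, fun x hx => if_neg hx⟩
  · rw [if_neg one_ne_zero, HahnSeries.order_one]
    rfl
  · intro x y
    by_cases hx : x = 0
    · rw [hx, zero_mul, if_pos rfl, zero_mul]
    by_cases hy : y = 0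
    · rw [hy, mul_zero, if_pos rfl, mul_zero]
    rw [if_neg (mul_ne_zero hx hy), if_neg hx, if_neg hy, HahnSeries.order_mul hx hy, ofLex_add,
      Prod.fst_add, neg_add, WithZero.exp_add]
  · intro x y
    by_cases hxy : x + y = 0
    · rw [hxy, if_pos rfl]
      exact zero_le
    by_cases hx : x = 0
    · rw [if_neg hxy, if_pos hx, hx, zero_add, if_neg (by simpa [hx] using hxy)]
      exact le_max_right _ _
    by_cases hy : y = 0
    · rw [if_neg hxy, if_pos hy, hy, add_zero, if_neg (by simpa [hy] using hxy)]
      exact le_max_left _ _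
    rw [if_neg hxy, if_neg hx, if_neg hy]
    have h := HahnSeries.min_order_le_order_add hxy
    rcases le_total x.order y.order with hle | hle
    · rw [min_eq_left hle] at h
      exact le_max_of_le_left (WithZero.exp_le_exp.mpr (neg_le_neg (Prod.Lex.monotone_fst _ _ h)))
    · rw [min_eq_right hle] at h
      exact le_max_of_le_right (WithZero.exp_le_exp.mpr (neg_le_neg (Prod.Lex.monotone_fst _ _ h)))

variable (v : Valuation (HK p) (WithZero (Multiplicative ℤ)))
  (hv : ∀ x : HK p, x ≠ 0 → v x = WithZero.exp (-(ofLex x.order).1))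
include hv

/-- `O₁ := O_v = {0} ∪ {x | 0 ≤ (order x).1}`. -/
theorem mem_fstValuationSubring_iff (x : HK p) :
    x ∈ v.valuationSubring ↔ x = 0 ∨ 0 ≤ (ofLex x.order).1 := by
  change v x ≤ 1 ↔ _
  by_cases hx : x = 0
  · simp [hx]
  · rw [hv x hx, ← WithZero.exp_zero, WithZero.exp_le_exp]
    simp [hx]

/-- `O ≤ O₁`. -/
theorem HO_le_fstValuationSubring : HO p ≤ v.valuationSubring := by
  intro x hx
  rw [mem_fstValuationSubring_iff p v hv]
  by_cases hx0 : x = 0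
  · exact Or.inl hx0
  · right
    rw [mem_HO_iff, ← HahnSeries.order_eq_orderTop_of_ne_zero hx0, WithTop.coe_nonneg] at hx
    exact Prod.Lex.monotone_fst _ _ hx

/-- `t^{(0,-1)} ∈ O₁ ∖ O`, so `O < O₁`. -/
theorem HO_lt_fstValuationSubring : HO p < v.valuationSubring := by
  refine lt_of_le_of_ne (HO_le_fstValuationSubring p v hv) ?_
  intro h
  set s : HK p := HahnSeries.single (toLex ((0 : ℤ), (-1 : ℤ))) 1 with hs
  have hs₁ : s ∈ v.valuationSubring := by
    rw [mem_fstValuationSubring_iff p v hv]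
    right
    rw [hs, HahnSeries.order_single one_ne_zero]
    simp
  have hsO : s ∉ HO p := by
    rw [mem_HO_iff, hs, HahnSeries.orderTop_single one_ne_zero, WithTop.coe_nonneg, Prod.Lex.le_iff]
    simp
  exact hsO (h ▸ hs₁)

/-- `t^{(-1,0)} ∉ O₁`, so `O₁ ≠ K`. -/
theorem fstValuationSubring_ne_top : v.valuationSubring ≠ ⊤ := by
  intro h
  set u : HK p := HahnSeries.single (toLex ((-1 : ℤ), (0 : ℤ))) 1 with hu
  have hu0 : u ≠ 0 := HahnSeries.single_ne_zero one_ne_zero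
  have hu₁ : u ∉ v.valuationSubring := by
    rw [mem_fstValuationSubring_iff p v hv, not_or, hu, HahnSeries.order_single one_ne_zero]
    exact ⟨hu0, by simp⟩
  exact hu₁ (h ▸ ValuationSubring.mem_top u)

/-- The value group of the first-coordinate valuation is non-trivial (`t^{(1,0)} ↦ exp (-1)`). -/
theorem nontrivial_valueGroup_fstVal :
    Nontrivial (MonoidWithZeroHom.valueGroup (MonoidWithZeroHom.ofClass v)) := by
  set t : HK p := HahnSeries.single (toLex ((1 : ℤ), (0 : ℤ))) 1 with ht
  have ht0 : t ≠ 0 := HahnSeries.single_ne_zero one_ne_zero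
  have hvt : v t = WithZero.exp (-1) := by
    rw [hv t ht0, ht, HahnSeries.order_single one_ne_zero]
    rfl
  let u : (WithZero (Multiplicative ℤ))ˣ := Units.mk0 (WithZero.exp (-1)) WithZero.exp_ne_zero
  have hu : u ∈ MonoidWithZeroHom.valueGroup (MonoidWithZeroHom.ofClass v) :=
    MonoidWithZeroHom.mem_valueGroup _ ⟨t, hvt⟩
  refine ⟨⟨⟨u, hu⟩, 1, ?_⟩⟩
  intro h
  have h' : (u : WithZero (Multiplicative ℤ)) = 1 := by
    have := congrArg (fun z : MonoidWithZeroHom.valueGroup (MonoidWithZeroHom.ofClass v) =>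
      ((z : (WithZero (Multiplicative ℤ))ˣ) : WithZero (Multiplicative ℤ))) h
    simpa using this
  rw [Units.val_mk0, ← WithZero.exp_zero, WithZero.exp_inj] at h'
  omega

/-- `O₁` is a discrete valuation ring (value group cyclic and non-trivial; Serre, *Local Fields* I §1
Prop. 1, in Mathlib), hence a regular local ring. -/
theorem isRegularLocalRing_fstValuationSubring : IsRegularLocalRing ↥v.valuationSubring := by
  haveI := nontrivial_valueGroup_fstVal p v hv
  infer_instance

/-- The steering hypothesis holds from stage `0`: every stage of the `O`-tower from `A = O` is `O`,
and `locAt O₁ O = O₁` is regular. -/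
theorem eventuallyRegularAlong_HO_HA : EventuallyRegularAlong (HO p) (HA p) v.valuationSubring := by
  refine ⟨0, fun m _ => ?_⟩
  show IsRegularLocalRing ↥(locAt v.valuationSubring (SyzygyFlattening.tower (HO p) (HA p) m))
  rw [sfTower_eq_tower, tower_valuationSubring, locAt_valuationSubalgebra_of_le (HO p)
    v.valuationSubring (algebraMap_mem_HO p) (HO_le_fstValuationSubring p v hv)]
  haveI := isRegularLocalRing_fstValuationSubring p v hv
  exact isRegularLocalRing_valuationSubalgebra v.valuationSubring _

omit hv in
/-- No stage of the `O`-tower from `A = O` is regular (`O` is not Noetherian). -/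
theorem not_towerTerminates_HO_HA : ¬ TowerTerminates (HO p) (HA p) := by
  rintro ⟨m, hm⟩
  rw [sfTower_eq_tower, tower_valuationSubring] at hm
  haveI : IsRegularLocalRing ↥(HA p) := hm
  exact not_isNoetherianRing_HA p inferInstance

end Witness

/-! ## The negative lemmas -/

/-- **`A.FG` is load-bearing for residual steering (every prime `p`).** The statement of the stub
`stub_residualSteering` of line `birth` at the prime `p`, with the single binder `A.FG` deleted, is
FALSE: witness the rank-two Hahn valuation ring `O` of `𝔽_p((t^{ℤ ×ₗ ℤ}))`, `A = O`, steered by its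
rank-one coarsening `O₁` (a DVR, at whose centre every stage is regular). -/
theorem residualSteering_false_without_FG (p : ℕ) [Fact p.Prime] :
    ¬ (∀ (k K : Type) [Field k] [CharP k p] [Field K] [Algebra k K] (O : ValuationSubring K)
        (A : Subalgebra k K), (∀ c : k, algebraMap k K c ∈ O) → IsFractionRing ↥A K →
        A.toSubring ≤ O.toSubring → DimZero k O →
        ∀ O₁ : ValuationSubring K, O < O₁ → O₁ ≠ ⊤ → EventuallyRegularAlong O A O₁ →
        TowerTerminates O A) := by
  intro H
  obtain ⟨v, hv⟩ := exists_fstVal p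
  exact not_towerTerminates_HO_HA p
    (H (ZMod p) (HK p) (HO p) (HA p) (algebraMap_mem_HO p) (isFractionRing_HA p) le_rfl
      (dimZero_HO p) v.valuationSubring (HO_lt_fstValuationSubring p v hv)
      (fstValuationSubring_ne_top p v hv) (eventuallyRegularAlong_HO_HA p v hv))

/-- **The stub `stub_residualSteering` minus `A.FG`, verbatim in its own quantifier shape, is false.** -/
theorem stub_residualSteering_false_without_FG :
    ¬ (∀ (p : ℕ), p.Prime →
        ∀ (k K : Type) [Field k] [CharP k p] [Field K] [Algebra k K] (O : ValuationSubring K)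
          (A : Subalgebra k K), (∀ c : k, algebraMap k K c ∈ O) → IsFractionRing ↥A K →
          A.toSubring ≤ O.toSubring → DimZero k O →
          ∀ O₁ : ValuationSubring K, O < O₁ → O₁ ≠ ⊤ → EventuallyRegularAlong O A O₁ →
          TowerTerminates O A) := by
  intro H
  haveI : Fact (Nat.Prime 2) := ⟨Nat.prime_two⟩
  exact residualSteering_false_without_FG 2 (H 2 Nat.prime_two)

end Summit.ResolutionOfSingularities.ResolutionOfSingularities.Theorems.HigherRankTermination.Negative
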